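import Summits.HodgeConjecture.HodgeConjecture.Theorems.Ring2WeilCoverageNormCriteria
import HarnessLib

/-!
# Weil-type family coverage — binary-tetrahedral Pryms on the NON-SPLIT `ℚ(√-3)` sixfold row R1 (ring2-b02, gen 59)

research route conditional on HC_CM; not a corollary; Q11.4-sentence-2 already refuted in dim ≥ 3.

Ring 2, WEIL-TYPE FAMILY-COVERAGE CENSUS (`HOME/WEIL-FAMILY-COVERAGE.md` `## b02 (g = 6)`, block b02.19 P.S. 2, owner
ring2-b02).  The binary tetrahedral group `2T = SL₂(𝔽₃)` has two characters `2′, 2″ = ρ₂ ⊗ λ^{±1}` of degree 2 with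
`ℚ(2′) = ℚ(√-3)` and Schur index ONE (`ρ₂` the quaternionic representation, `λ` the cubic character through `2T/Q₈`);
realised over `K = ℚ(ω)` by `i ↦ [[0,−1],[1,0]]`, `j ↦ [[ω²,ω],[ω,−ω²]]`.  By THEOREM R of b02.19 (Lange–Rodríguez
Cor. 3.5.10; Ellenberg §1) the `(2′ ⊕ 2″)`-isotypic piece `P` of a `2T`-curve is `B²`, `B = e₁₁P`, and since
`Ind_{C₆}^{2T}(sgn) = 2′ ⊕ 2″`, i.e. `ρ_{C₃} = ρ_{C₆} ⊕ (2′ ⊕ 2″)`, the factor is the PRYM `B ~ P(C̃/C₃ → C̃/C₆)` of a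
double cover.  The census engine `smono.py` (exact: Morita-reduced Fox/fatgraph model, van Geemen's `H = S + θE`,
Hilbert symbols; cross-checked by the independent polygon `H¹` engine of gen 51) finds for the genus-0 data of Weil
type `(3,3)` the literal determinants below; the class is `[2]^{#(branch points of type −1)}` (LEMMA 8 of the census:
THEOREM U's LU identity in `M₂(K)` with `det(1−ρ(c)) = 4, 2, −2ω, −2ω²` on the classes `−1, 4, 6A, 6B` and
`det h_W = 864 ≡ 6`).  THIS FILE pins the arithmetic: three data land on the NON-SPLIT component
`(3, ℚ(√-3), [−2])` = row W6.3.2 = pub-hsemireg's TARGET row R1 — where the algebraicity of the Weil classes is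
OPEN in print — and three controls on the split row R0.  The non-split statements are reduced to the cell's
`Ring2AbelianAll.NonsplitNormObstruction.negTwo_ne_splitDiscriminantClass` (`[−2] ≠ [(−1)³]`, descent at the
inert prime 2); nothing else is used.  The monodromy statements of the census (Zariski density in `SU(3,3)`,
hence `End⁰ = ℚ(√-3)` and `Hg = SU(3,3)` for the very general member) are exact computations, not kernel facts.

No `def`, no named fact, no `sorry`; nothing here is a statement about Hodge classes; `HC_CM` is used nowhere.

References: [cite: vanGeemen1994HodgeAV, 5.2 and (5.4.1)].
-/

noncomputable section

set_option linter.dupNamespace false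

open Literature.AlgebraicGeometry.Motives
open Literature.AlgebraicGeometry.VanGeemen1994
open Summit.HodgeConjecture.HodgeConjecture.Ring2.Hypotheses
open Summit.HodgeConjecture.Ring2AbelianAll.NonsplitNormObstruction

namespace Summit.HodgeConjecture.HodgeConjecture.Ring2.WeilCoverage

/-- **the `2T′`-factor `B_t = e₁₁P_t` of the `2T = SL₂(𝔽₃)`-covers of `ℙ¹` of type `(0; −1,4,4,6A,6B)` (genus 21; all 72 admissible tuples in ONE braid orbit; 2-parameter family), which is the PRYM of the double cover `C̃/C₃ → C̃/C₆` of a genus-7 curve over an elliptic curve (`ρ_{C₃} = ρ_{C₆} ⊕ (2′ ⊕ 2″)`): `dim 6`, `ℚ(√-3)`-signature `(3,3)`, literal `det H = −1/128`; `(−1/128)⁻¹·(−2) = 256 = 16² + 3·0²` is a norm, so its class is `[−2]`, the NON-split row `W6.3.2 = R1 = (3, ℚ(√-3), a ≡ 2)`; monodromy Zariski-dense in `SU(3,3)` (35/35), so the very general member has `Hg = SU(3,3)`, `End⁰ = ℚ(√-3)`.**  The class of `det H` equals the class `[−2]` of the cell's anchors `E_ω³ × Ē_ω³` of type `(1⁵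,2)`.
research route conditional on HC_CM; not a corollary; Q11.4-sentence-2 already refuted in dim ≥ 3. [cite: vanGeemen1994HodgeAV, (5.4.1)] -/
theorem prym2T_m1_4_4_6A_6B_mk_detH_eq_negTwo :
    (QuotientGroup.mk (Units.mk0 ((-1 : ℚ) / 128) (by norm_num)) : weilNormResidueGroup 3) =
      QuotientGroup.mk (Units.mk0 (-2 : ℚ) (by norm_num)) := by
  rw [QuotientGroup.eq]
  have e : (Units.mk0 ((-1 : ℚ) / 128) (by norm_num))⁻¹ * Units.mk0 (-2 : ℚ) (by norm_num) =
      Units.mk0 (256 : ℚ) (by norm_num) := Units.ext (by norm_num)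
  rw [e]
  exact mem_normUnitsSubgroup_of_sq_add_mul_sq _ (16 : ℚ) (0 : ℚ) (by norm_num)

/-- **… hence NOT the split class: the piece lies on the non-split row `W6.3.2 = (3, ℚ(√-3), a ≡ 2)` (R1), which has no
hyperbolic member** (`negTwo_ne_splitDiscriminantClass`: `2 ∉ Nm(ℚ(√-3)ˣ)`, descent at the inert prime 2).
research route conditional on HC_CM; not a corollary; Q11.4-sentence-2 already refuted in dim ≥ 3. [cite: vanGeemen1994HodgeAV, (5.4.1)] -/
theorem prym2T_m1_4_4_6A_6B_mk_detH_ne_split :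
    (QuotientGroup.mk (Units.mk0 ((-1 : ℚ) / 128) (by norm_num)) : weilNormResidueGroup 3) ≠
      splitDiscriminantClass 3 3 := by
  rw [prym2T_m1_4_4_6A_6B_mk_detH_eq_negTwo]
  exact negTwo_ne_splitDiscriminantClass

/-- **the `2T′`-factor over `(0; −1,6A,6A,6B,6B)` (genus 23; 24 tuples, one orbit; 2 parameters): again the Prym of a genus-7 double cover of an elliptic curve, `(3,3)`, `det H = −1/128`, class `[−2]` = row `W6.3.2` (R1); `SU(3,3)` dense.**  The class of `det H` equals the class `[−2]` of the cell's anchors `E_ω³ × Ē_ω³` of type `(1⁵,2)`.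
research route conditional on HC_CM; not a corollary; Q11.4-sentence-2 already refuted in dim ≥ 3. [cite: vanGeemen1994HodgeAV, (5.4.1)] -/
theorem prym2T_m1_6A_6A_6B_6B_mk_detH_eq_negTwo :
    (QuotientGroup.mk (Units.mk0 ((-1 : ℚ) / 128) (by norm_num)) : weilNormResidueGroup 3) =
      QuotientGroup.mk (Units.mk0 (-2 : ℚ) (by norm_num)) := by
  rw [QuotientGroup.eq]
  have e : (Units.mk0 ((-1 : ℚ) / 128) (by norm_num))⁻¹ * Units.mk0 (-2 : ℚ) (by norm_num) =
      Units.mk0 (256 : ℚ) (by norm_num) := Units.ext (by norm_num)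
  rw [e]
  exact mem_normUnitsSubgroup_of_sq_add_mul_sq _ (16 : ℚ) (0 : ℚ) (by norm_num)

/-- **… hence NOT the split class: the piece lies on the non-split row `W6.3.2 = (3, ℚ(√-3), a ≡ 2)` (R1), which has no
hyperbolic member** (`negTwo_ne_splitDiscriminantClass`: `2 ∉ Nm(ℚ(√-3)ˣ)`, descent at the inert prime 2).
research route conditional on HC_CM; not a corollary; Q11.4-sentence-2 already refuted in dim ≥ 3. [cite: vanGeemen1994HodgeAV, (5.4.1)] -/
theorem prym2T_m1_6A_6A_6B_6B_mk_detH_ne_split :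
    (QuotientGroup.mk (Units.mk0 ((-1 : ℚ) / 128) (by norm_num)) : weilNormResidueGroup 3) ≠
      splitDiscriminantClass 3 3 := by
  rw [prym2T_m1_6A_6A_6B_6B_mk_detH_eq_negTwo]
  exact negTwo_ne_splitDiscriminantClass

/-- **the `2T′`-factor over `(0; −1,−1,−1,3A,3B,4)` (genus 20; 12 tuples, one orbit; 3-parameter family): here `C̃/C₆ ≅ ℙ¹`, so `B_t ~ J(C̃/C₃)`, the Jacobian of a HYPERELLIPTIC genus-6 curve; `(3,3)`, `det H = −3/128`; `(−3/128)⁻¹·(−2) = 256/3 = 8² + 3·(8/3)²`, class `[−2]` = row `W6.3.2` (R1); `SU(3,3)` dense.**  The class of `det H` equals the class `[−2]` of the cell's anchors `E_ω³ × Ē_ω³` of type `(1⁵,2)`.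
research route conditional on HC_CM; not a corollary; Q11.4-sentence-2 already refuted in dim ≥ 3. [cite: vanGeemen1994HodgeAV, (5.4.1)] -/
theorem hyperellipticJacobian2T_m1_m1_m1_3A_3B_4_mk_detH_eq_negTwo :
    (QuotientGroup.mk (Units.mk0 ((-3 : ℚ) / 128) (by norm_num)) : weilNormResidueGroup 3) =
      QuotientGroup.mk (Units.mk0 (-2 : ℚ) (by norm_num)) := by
  rw [QuotientGroup.eq]
  have e : (Units.mk0 ((-3 : ℚ) / 128) (by norm_num))⁻¹ * Units.mk0 (-2 : ℚ) (by norm_num) =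
      Units.mk0 ((256 : ℚ) / 3) (by norm_num) := Units.ext (by norm_num)
  rw [e]
  exact mem_normUnitsSubgroup_of_sq_add_mul_sq _ (8 : ℚ) ((8 : ℚ) / 3) (by norm_num)

/-- **… hence NOT the split class: the piece lies on the non-split row `W6.3.2 = (3, ℚ(√-3), a ≡ 2)` (R1), which has no
hyperbolic member** (`negTwo_ne_splitDiscriminantClass`: `2 ∉ Nm(ℚ(√-3)ˣ)`, descent at the inert prime 2).
research route conditional on HC_CM; not a corollary; Q11.4-sentence-2 already refuted in dim ≥ 3. [cite: vanGeemen1994HodgeAV, (5.4.1)] -/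
theorem hyperellipticJacobian2T_m1_m1_m1_3A_3B_4_mk_detH_ne_split :
    (QuotientGroup.mk (Units.mk0 ((-3 : ℚ) / 128) (by norm_num)) : weilNormResidueGroup 3) ≠
      splitDiscriminantClass 3 3 := by
  rw [hyperellipticJacobian2T_m1_m1_m1_3A_3B_4_mk_detH_eq_negTwo]
  exact negTwo_ne_splitDiscriminantClass

/-- **the `2T′`-factor over `(0; −1,−1,4,6A,6B)` (genus 18; 12 tuples, one orbit; 2 parameters): `C̃/C₆ ≅ ℙ¹`, `B_t ~ J(C̃/C₃)` with `C̃/C₃` hyperelliptic of genus 6; `(3,3)`, `det H = −1/64`, `a = 1/64 = (1/8)²` — the SPLIT row `W6.3.1` (R0); `SU(3,3)` dense.**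
research route conditional on HC_CM; not a corollary; Q11.4-sentence-2 already refuted in dim ≥ 3. [cite: vanGeemen1994HodgeAV, (5.4.1)] -/
theorem hyperellipticJacobian2T_m1_m1_4_6A_6B_mk_detH_eq_split :
    (QuotientGroup.mk (Units.mk0 ((-1 : ℚ) / 64) (by norm_num)) : weilNormResidueGroup 3) =
      splitDiscriminantClass 3 3 := by
  have e : Units.mk0 ((-1 : ℚ) / 64) (by norm_num) = -(Units.mk0 ((1 : ℚ) / 64) (by norm_num)) :=
    Units.ext (by norm_num)
  rw [e, mk_neg_eq_splitDiscriminantClass_iff_of_odd (n := 3) (by decide)]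
  exact mem_normUnitsSubgroup_of_sq_add_mul_sq _ ((1 : ℚ) / 8) (0 : ℚ) (by norm_num)

/-- **the `2T′`-factor over `(0; 4,4,4,6A,6B)` (432 tuples, one orbit; 2 parameters): `(3,3)`, `det H = −1/64` — split row `W6.3.1`; `SU(3,3)` dense.**
research route conditional on HC_CM; not a corollary; Q11.4-sentence-2 already refuted in dim ≥ 3. [cite: vanGeemen1994HodgeAV, (5.4.1)] -/
theorem prym2T_4_4_4_6A_6B_mk_detH_eq_split :
    (QuotientGroup.mk (Units.mk0 ((-1 : ℚ) / 64) (by norm_num)) : weilNormResidueGroup 3) =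
      splitDiscriminantClass 3 3 := by
  have e : Units.mk0 ((-1 : ℚ) / 64) (by norm_num) = -(Units.mk0 ((1 : ℚ) / 64) (by norm_num)) :=
    Units.ext (by norm_num)
  rw [e, mk_neg_eq_splitDiscriminantClass_iff_of_odd (n := 3) (by decide)]
  exact mem_normUnitsSubgroup_of_sq_add_mul_sq _ ((1 : ℚ) / 8) (0 : ℚ) (by norm_num)

/-- **the `2T′`-factor over `(0; −1,−1,3A,3B,4,4)` (72 tuples, one orbit; 3 parameters): `(3,3)`, `det H = −9/256`, `a = (3/16)²` — split row `W6.3.1`; `SU(3,3)` dense.**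
research route conditional on HC_CM; not a corollary; Q11.4-sentence-2 already refuted in dim ≥ 3. [cite: vanGeemen1994HodgeAV, (5.4.1)] -/
theorem prym2T_m1_m1_3A_3B_4_4_mk_detH_eq_split :
    (QuotientGroup.mk (Units.mk0 ((-9 : ℚ) / 256) (by norm_num)) : weilNormResidueGroup 3) =
      splitDiscriminantClass 3 3 := by
  have e : Units.mk0 ((-9 : ℚ) / 256) (by norm_num) = -(Units.mk0 ((9 : ℚ) / 256) (by norm_num)) :=
    Units.ext (by norm_num)
  rw [e, mk_neg_eq_splitDiscriminantClass_iff_of_odd (n := 3) (by decide)]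
  exact mem_normUnitsSubgroup_of_sq_add_mul_sq _ ((3 : ℚ) / 16) (0 : ℚ) (by norm_num)

/-! ### gen 60 (block b02.20): the genus-2 base datum `(2; −1)` (ring2-b04's `(2;2)`), certified by LEMMA AS as well

The `2T′`-factor of the `2T`-covers of a genus-2 curve with ONE branch point of type `−1` (genus 31; ALL 30720 admissible
monodromy tuples form a single orbit of the genus-2 mapping-class moves, so the family is irreducible; `3g − 3 + N = 4`
parameters — the largest R1 family of the census): `dim B = 6` (= Chevalley–Weil), unique invariant alternating form,
`ℚ(√-3)`-signature `(3,3)`, literal `det H = −32`; `(−32)⁻¹·(−2) = 1/16 = (1/4)² + 3·0²` is a norm, so the class is `[−2]`: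
the NON-split row W6.3.2 = R1, in CONCORDANCE with ring2-b04's independent `det H|_B = −279/2` (same class).  Monodromy:
Lie closure 35/35 AND the exterior/symmetric-square certificate (LEMMA AS of b02.20: one braid loop of infinite order +
commutant nullities `(1,1)` on `Λ²V_σ`, `Sym²V_σ` modulo a split prime), so the very general member has `Hg = SU(3,3)`,
`End⁰ = ℚ(√-3)`.  research route conditional on HC_CM; not a corollary; Q11.4-sentence-2 already refuted in dim ≥ 3. -/

/-- **the `2T′`-factor over the genus-2 base datum `(2; −1)` (genus 31, 30720 tuples = one orbit, 4 parameters): `(3,3)`, literal `det H = −32`, class `[−2]` = the NON-split row `W6.3.2 = R1`** (`(−32)⁻¹·(−2) = (1/4)²`).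
research route conditional on HC_CM; not a corollary; Q11.4-sentence-2 already refuted in dim ≥ 3. [cite: vanGeemen1994HodgeAV, (5.4.1)] -/
theorem prym2T_g2_m1_mk_detH_eq_negTwo :
    (QuotientGroup.mk (Units.mk0 (-32 : ℚ) (by norm_num)) : weilNormResidueGroup 3) =
      QuotientGroup.mk (Units.mk0 (-2 : ℚ) (by norm_num)) := by
  rw [QuotientGroup.eq]
  have e : (Units.mk0 (-32 : ℚ) (by norm_num))⁻¹ * Units.mk0 (-2 : ℚ) (by norm_num) =
      Units.mk0 ((1 : ℚ) / 16) (by norm_num) := Units.ext (by norm_num)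
  rw [e]
  exact mem_normUnitsSubgroup_of_sq_add_mul_sq _ ((1 : ℚ) / 4) (0 : ℚ) (by norm_num)

/-- **… hence NOT the split class: the 4-parameter genus-2 family lies on the non-split row `W6.3.2` (R1), which has no hyperbolic member.**
research route conditional on HC_CM; not a corollary; Q11.4-sentence-2 already refuted in dim ≥ 3. [cite: vanGeemen1994HodgeAV, (5.4.1)] -/
theorem prym2T_g2_m1_mk_detH_ne_split :
    (QuotientGroup.mk (Units.mk0 (-32 : ℚ) (by norm_num)) : weilNormResidueGroup 3) ≠
      splitDiscriminantClass 3 3 := by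
  rw [prym2T_g2_m1_mk_detH_eq_negTwo]
  exact negTwo_ne_splitDiscriminantClass

/-- **ring2-b04's independent determinant for the same component, `det H|_B = −279/2` (b04.12 P.S. 3, their frame), has the SAME class `[−2]`: `(−279/2)⁻¹·(−2) = 4/279`, and `4/279 · 279² = 1116 = 33² + 3·3²`, so `4/279 = (33/279)² + 3·(3/279)²` is a norm** — the two engines CONCUR on the row of the genus-2 family.
research route conditional on HC_CM; not a corollary; Q11.4-sentence-2 already refuted in dim ≥ 3. [cite: vanGeemen1994HodgeAV, (5.4.1)] -/
theorem prym2T_g2_m1_b04_mk_detH_eq_negTwo :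
    (QuotientGroup.mk (Units.mk0 ((-279 : ℚ) / 2) (by norm_num)) : weilNormResidueGroup 3) =
      QuotientGroup.mk (Units.mk0 (-2 : ℚ) (by norm_num)) := by
  rw [QuotientGroup.eq]
  have e : (Units.mk0 ((-279 : ℚ) / 2) (by norm_num))⁻¹ * Units.mk0 (-2 : ℚ) (by norm_num) =
      Units.mk0 ((4 : ℚ) / 279) (by norm_num) := Units.ext (by norm_num)
  rw [e]
  exact mem_normUnitsSubgroup_of_sq_add_mul_sq _ ((33 : ℚ) / 279) ((3 : ℚ) / 279) (by norm_num)

end Summit.HodgeConjecture.HodgeConjecture.Ring2.WeilCoverage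

end
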